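import Summits.Ventures.PercRepro.C025ProfilePLDClosureArith

/-!
# THE SOLID U_{4,m} FOR EVERY m ≥ m₀ FROM THE CASE m = m₀ AND TWO PRESERVERS: THE ARITHMETIC (night-3 g31)

`proofs/NIGHT3-G31-TWOLIFT.md` §7.  The profile of `U_{4,m}`, `m ≥ 7`, is `T₀₄ + m·T₁₄ + C(m,2)·T₂₄ + C(m,3)·T₃₄ + c_m·δ₄₄`
(`sum_choose_min_four`, `c_m = Σ_{4 ≤ i ≤ m−4} C(m,i)`), `m ↦ c_m` non-decreasing.  With `m = m₀ + k`:
`6·(U_{4,m} − U_{4,m₀}) = k·q₄ + 3k²·q₄′ + k²(3m₀ + k − 12)·T₃₄ + 6(c_m − c_{m₀})·δ₄₄` where `q₄ = 6·T₁₄ + 3(2m₀−1)·T₂₄ +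
(3m₀² − 6m₀ + 2)·T₃₄` and `q₄′ = T₂₄ + 3·T₃₄` (`six_mul_choose_two_sub`, `six_mul_choose_three_sub`, `lift_alg_solid`).  `T₃₄`
(`PLDClosure.coloop` after `shift11` three times) and `δ₄₄` (`shift11` four times) preserve PER-LAYER DOMINANCE (g29); `q₄` and
`q₄′` do at bounded rank (certificate tables); hence the lift `lift_instance_solid` for `7 ≤ m₀ ≤ m`.  No `def`, no `instance`,
no notation.  Axioms: standard.
-/

namespace PercRepro

open Finset

namespace PLDSolidLift

variable {ι : Type}

/-- The uniform profile of `U_{4,m}`, `m ≥ 7`. -/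
theorem sum_choose_min_four (m : ℕ) (hm : 7 ≤ m) (g : ℕ → ℕ → ℕ) :
    ∑ i ∈ range (m + 1), m.choose i * g (min i 4) (min (m - i) 4) =
      g 0 4 + m * g 1 4 + m.choose 2 * g 2 4 + m.choose 3 * g 3 4 + (∑ i ∈ Ico 4 (m - 3), m.choose i) * g 4 4 +
        m.choose 3 * g 4 3 + m.choose 2 * g 4 2 + m * g 4 1 + g 4 0 := by
  obtain ⟨k, rfl⟩ : ∃ k, m = k + 7 := ⟨m - 7, by omega⟩
  rw [sum_range_succ, sum_range_succ, sum_range_succ, sum_range_succ, sum_range_succ', sum_range_succ',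
    sum_range_succ', sum_range_succ']
  have hmid : ∀ i ∈ range k, (k + 7).choose (i + 1 + 1 + 1 + 1) * g (min (i + 1 + 1 + 1 + 1) 4)
      (min (k + 7 - (i + 1 + 1 + 1 + 1)) 4) = (k + 7).choose (i + 1 + 1 + 1 + 1) * g 4 4 := by
    intro i hi
    rw [mem_range] at hi
    rw [show min (i + 1 + 1 + 1 + 1) 4 = 4 by omega, show min (k + 7 - (i + 1 + 1 + 1 + 1)) 4 = 4 by omega]
  rw [sum_congr rfl hmid, ← sum_mul, show k + 7 - 3 = k + 4 by omega, sum_Ico_eq_sum_range,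
    show k + 4 - 4 = k by omega]
  have hc : ∑ i ∈ range k, (k + 7).choose (4 + i) = ∑ i ∈ range k, (k + 7).choose (i + 1 + 1 + 1 + 1) :=
    sum_congr rfl fun i _ => by rw [show 4 + i = i + 1 + 1 + 1 + 1 by omega]
  have h1 : (k + 7).choose (0 + 1) = k + 7 := Nat.choose_one_right _
  have h2 : (k + 7).choose (k + 6) = k + 7 := Nat.choose_succ_self_right (k + 6)
  have h3 : (k + 7).choose (k + 5) = (k + 7).choose 2 := by
    rw [← Nat.choose_symm (by omega : 2 ≤ k + 7), show k + 7 - 2 = k + 5 by omega]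
  have h4 : (k + 7).choose (k + 4) = (k + 7).choose 3 := by
    rw [← Nat.choose_symm (by omega : 3 ≤ k + 7), show k + 7 - 3 = k + 4 by omega]
  rw [hc, Nat.choose_zero_right, Nat.choose_self, h1, h2, h3, h4]
  simp only [show min (0 + 1) 4 = 1 by omega, show min (k + 6) 4 = 4 by omega, show min 0 4 = 0 by omega,
    show k + 7 - 0 = k + 7 by omega, show min (k + 7) 4 = 4 by omega, show k + 7 - (k + 6) = 1 by omega,
    show k + 7 - (k + 7) = 0 by omega, show min (0 + 1 + 1) 4 = 2 by omega, show min (k + 5) 4 = 4 by omega,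
    show k + 7 - (k + 5) = 2 by omega, show min (0 + 1 + 1 + 1) 4 = 3 by omega, show min (k + 4) 4 = 4 by omega,
    show k + 7 - (k + 4) = 3 by omega, show min (k + 7 - (0 + 1)) 4 = 4 by omega,
    show min (k + 7 - (0 + 1 + 1)) 4 = 4 by omega, one_mul]
  ring

/-- `c_{m₀} ≤ c_m` for `m₀ ≤ m`. -/
theorem sum_choose_mid4_mono (m₀ m : ℕ) (hm : m₀ ≤ m) :
    ∑ i ∈ Ico 4 (m₀ - 3), m₀.choose i ≤ ∑ i ∈ Ico 4 (m - 3), m.choose i := by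
  calc ∑ i ∈ Ico 4 (m₀ - 3), m₀.choose i ≤ ∑ i ∈ Ico 4 (m₀ - 3), m.choose i :=
        sum_le_sum fun i _ => Nat.choose_le_choose i hm
    _ ≤ ∑ i ∈ Ico 4 (m - 3), m.choose i :=
        sum_le_sum_of_subset_of_nonneg (Ico_subset_Ico le_rfl (by omega)) fun _ _ _ => Nat.zero_le _

/-- `2·C(m,2) = m·(m−1)`. -/
theorem two_mul_choose_two (m : ℕ) : 2 * m.choose 2 = m * (m - 1) := by
  rw [Nat.choose_two_right, Nat.two_mul_div_two_of_even (Nat.even_mul_pred_self m)]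

/-- `6·C(m,3) = m·(m−1)·(m−2)`. -/
theorem six_mul_choose_three (m : ℕ) : 6 * m.choose 3 = m * (m - 1) * (m - 2) := by
  rcases m with _ | n
  · rfl
  · have h := Nat.add_one_mul_choose_eq n 2
    have h2 := two_mul_choose_two n
    calc 6 * (n + 1).choose 3 = 2 * ((n + 1).choose (2 + 1) * (2 + 1)) := by ring
      _ = 2 * ((n + 1) * n.choose 2) := by rw [h]
      _ = (n + 1) * (2 * n.choose 2) := by ring
      _ = (n + 1) * (n * (n - 1)) := by rw [h2]
      _ = (n + 1) * (n + 1 - 1) * (n + 1 - 2) := by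
        rcases n with _ | n
        · rfl
        · rw [show n + 1 + 1 - 1 = n + 1 by omega, show n + 1 + 1 - 2 = n by omega, show n + 1 - 1 = n by omega]
          ring

/-- `6·(C(m₀+k, 2) − C(m₀, 2)) = 3k·(2m₀ + k − 1)`, subtraction-free, for `m₀ ≥ 1`. -/
theorem six_mul_choose_two_sub (m₀ k : ℕ) (hm₀ : 1 ≤ m₀) :
    6 * (m₀ + k).choose 2 = 6 * m₀.choose 2 + 3 * k * (2 * m₀ + k - 1) := by
  obtain ⟨n, rfl⟩ : ∃ n, m₀ = n + 1 := ⟨m₀ - 1, by omega⟩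
  have h1 := two_mul_choose_two (n + 1 + k)
  have h2 := two_mul_choose_two (n + 1)
  rw [show n + 1 + k - 1 = n + k by omega] at h1
  rw [show n + 1 - 1 = n by omega] at h2
  rw [show 2 * (n + 1) + k - 1 = 2 * n + k + 1 by omega]
  nlinarith [h1, h2]

/-- `6·(C(m₀+k, 3) − C(m₀, 3)) = k·(3m₀² + 3m₀k + k² − 6m₀ − 3k + 2)`, subtraction-free, for `m₀ ≥ 2`. -/
theorem six_mul_choose_three_sub (m₀ k : ℕ) (hm₀ : 2 ≤ m₀) :
    6 * (m₀ + k).choose 3 + k * (6 * m₀ + 3 * k) =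
      6 * m₀.choose 3 + k * (3 * m₀ * m₀ + 3 * m₀ * k + k * k + 2) := by
  obtain ⟨n, rfl⟩ : ∃ n, m₀ = n + 2 := ⟨m₀ - 2, by omega⟩
  have h1 := six_mul_choose_three (n + 2 + k)
  have h2 := six_mul_choose_three (n + 2)
  rw [show n + 2 + k - 1 = n + k + 1 by omega, show n + 2 + k - 2 = n + k by omega] at h1
  rw [show n + 2 - 1 = n + 1 by omega, show n + 2 - 2 = n by omega] at h2
  nlinarith [h1, h2]

/-- The linear algebra of the solid lift from `m₀ = 7`, with the eighteen layer sums and the coefficients abstracted: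
`6·C₂ = 126 + 39k + 3k²`, `6·C₃ = 210 + 107k + 18k² + k³` (`C₂ = C(7+k, 2)`, `C₃ = C(7+k, 3)`). -/
theorem lift_alg_solid (a04 a14 a24 a34 a44 a43 a42 a41 a40 b04 b14 b24 b34 b44 b43 b42 b41 b40 k k' C2 C3 c₀ : ℕ)
    (hC2 : 6 * C2 = 126 + 39 * k + 3 * k * k) (hC3 : 6 * C3 = 210 + 107 * k + 18 * k * k + k * k * k)
    (h₀ : a04 + 7 * a14 + 21 * a24 + 35 * a34 + c₀ * a44 + 35 * a43 + 21 * a42 + 7 * a41 + a40 ≤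
      b04 + 7 * b14 + 21 * b24 + 35 * b34 + c₀ * b44 + 35 * b43 + 21 * b42 + 7 * b41 + b40)
    (hq : 6 * (a14 + a41) + 39 * (a24 + a42) + 107 * (a34 + a43) ≤ 6 * (b14 + b41) + 39 * (b24 + b42) + 107 * (b34 + b43))
    (hq' : (a24 + a42) + 3 * (a34 + a43) ≤ (b24 + b42) + 3 * (b34 + b43))
    (hT : a34 + a43 ≤ b34 + b43) (hS : a44 ≤ b44) :
    a04 + (7 + k) * a14 + C2 * a24 + C3 * a34 + (c₀ + k') * a44 + C3 * a43 + C2 * a42 + (7 + k) * a41 + a40 ≤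
      b04 + (7 + k) * b14 + C2 * b24 + C3 * b34 + (c₀ + k') * b44 + C3 * b43 + C2 * b42 + (7 + k) * b41 + b40 := by
  have e1 : 6 * C2 * a24 = (126 + 39 * k + 3 * k * k) * a24 := by rw [hC2]
  have e2 : 6 * C2 * a42 = (126 + 39 * k + 3 * k * k) * a42 := by rw [hC2]
  have e3 : 6 * C2 * b24 = (126 + 39 * k + 3 * k * k) * b24 := by rw [hC2]
  have e4 : 6 * C2 * b42 = (126 + 39 * k + 3 * k * k) * b42 := by rw [hC2]
  have f1 : 6 * C3 * a34 = (210 + 107 * k + 18 * k * k + k * k * k) * a34 := by rw [hC3]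
  have f2 : 6 * C3 * a43 = (210 + 107 * k + 18 * k * k + k * k * k) * a43 := by rw [hC3]
  have f3 : 6 * C3 * b34 = (210 + 107 * k + 18 * k * k + k * k * k) * b34 := by rw [hC3]
  have f4 : 6 * C3 * b43 = (210 + 107 * k + 18 * k * k + k * k * k) * b43 := by rw [hC3]
  have hqk := Nat.mul_le_mul_left k hq
  have hq'k := Nat.mul_le_mul_left (3 * k * k) hq'
  have hTk := Nat.mul_le_mul_left (k * k * (9 + k)) hT
  have hSk := Nat.mul_le_mul_left (6 * k') hS
  linarith [e1, e2, e3, e4, f1, f2, f3, f4, hqk, hq'k, hTk, hSk, h₀]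

set_option maxHeartbeats 400000 in
/-- THE LIFT IN `m` FOR SOLIDS from `m₀ = 7`: for a family `(s, x, f)` with (PLD), `7 ≤ m`, an admissible `(lo, hi, δ, Θ)`, the
`q₄`-instance (`6·T₁₄ + 39·T₂₄ + 107·T₃₄`), the `q₄′`-instance (`T₂₄ + 3·T₃₄`) and the `U_{4,7}`-instance give the `U_{4,m}`-instance. -/
theorem lift_instance_solid (s : Finset ι) (x f : ι → ℕ)
    (hPLD : ∀ lo hi δ Θ : ℕ, Θ ≤ lo + hi + δ → (lo = 0 ∨ lo + hi + δ ≤ Θ) →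
      ∑ i ∈ s, (if lo ≤ x i ∧ x i ≤ hi ∧ Θ ≤ f i + x i then (f i).choose δ else 0) ≤
        ∑ i ∈ s, (if lo + δ ≤ f i ∧ f i ≤ hi + δ then (f i).choose δ else 0))
    (m : ℕ) (hm : 7 ≤ m) (lo hi δ Θ : ℕ) (hΘ : Θ ≤ lo + hi + δ) (hlo : lo = 0 ∨ lo + hi + δ ≤ Θ)
    (hq : ∑ i ∈ s, (6 * ((if lo ≤ x i + 1 ∧ x i + 1 ≤ hi ∧ Θ ≤ (f i + 4) + (x i + 1) then (f i + 4).choose δ else 0) + (if lo ≤ x i + 4 ∧ x i + 4 ≤ hi ∧ Θ ≤ (f i + 1) + (x i + 4) then (f i + 1).choose δ else 0)) + 39 * ((if lo ≤ x i + 2 ∧ x i + 2 ≤ hi ∧ Θ ≤ (f i + 4) + (x i + 2) then (f i + 4).choose δ else 0) + (if lo ≤ x i + 4 ∧ x i + 4 ≤ hi ∧ Θ ≤ (f i + 2) + (x i + 4) then (f i + 2).choose δ else 0)) + 107 * ((if lo ≤ x i + 3 ∧ x i + 3 ≤ hi ∧ Θ ≤ (f i + 4) + (x i + 3) then (f i +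 4).choose δ else 0) + (if lo ≤ x i + 4 ∧ x i + 4 ≤ hi ∧ Θ ≤ (f i + 3) + (x i + 4) then (f i + 3).choose δ else 0))) ≤
      ∑ i ∈ s, (6 * ((if lo + δ ≤ f i + 4 ∧ f i + 4 ≤ hi + δ then (f i + 4).choose δ else 0) + (if lo + δ ≤ f i + 1 ∧ f i + 1 ≤ hi + δ then (f i + 1).choose δ else 0)) + 39 * ((if lo + δ ≤ f i + 4 ∧ f i + 4 ≤ hi + δ then (f i + 4).choose δ else 0) + (if lo + δ ≤ f i + 2 ∧ f i + 2 ≤ hi + δ then (f i + 2).choose δ else 0)) + 107 * ((if lo + δ ≤ f i + 4 ∧ f i + 4 ≤ hi + δ then (f i + 4).choose δ else 0) + (if lo + δ ≤ f i + 3 ∧ f i + 3 ≤ hi + δ then (f i + 3).choose δ else 0))))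
    (hq' : ∑ i ∈ s, (((if lo ≤ x i + 2 ∧ x i + 2 ≤ hi ∧ Θ ≤ (f i + 4) + (x i + 2) then (f i + 4).choose δ else 0) + (if lo ≤ x i + 4 ∧ x i + 4 ≤ hi ∧ Θ ≤ (f i + 2) + (x i + 4) then (f i + 2).choose δ else 0)) + 3 * ((if lo ≤ x i + 3 ∧ x i + 3 ≤ hi ∧ Θ ≤ (f i + 4) + (x i + 3) then (f i + 4).choose δ else 0) + (if lo ≤ x i + 4 ∧ x i + 4 ≤ hi ∧ Θ ≤ (f i + 3) + (x i + 4) then (f i + 3).choose δ else 0))) ≤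
      ∑ i ∈ s, (((if lo + δ ≤ f i + 4 ∧ f i + 4 ≤ hi + δ then (f i + 4).choose δ else 0) + (if lo + δ ≤ f i + 2 ∧ f i + 2 ≤ hi + δ then (f i + 2).choose δ else 0)) + 3 * ((if lo + δ ≤ f i + 4 ∧ f i + 4 ≤ hi + δ then (f i + 4).choose δ else 0) + (if lo + δ ≤ f i + 3 ∧ f i + 3 ≤ hi + δ then (f i + 3).choose δ else 0))))
    (h₀ : ∑ i ∈ s, ∑ j ∈ range (7 + 1), Nat.choose 7 j *
        (if lo ≤ x i + min j 4 ∧ x i + min j 4 ≤ hi ∧ Θ ≤ (f i + min (7 - j) 4) + (x i + min j 4) then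
          (f i + min (7 - j) 4).choose δ else 0) ≤
      ∑ i ∈ s, ∑ j ∈ range (7 + 1), Nat.choose 7 j *
        (if lo + δ ≤ f i + min (7 - j) 4 ∧ f i + min (7 - j) 4 ≤ hi + δ then (f i + min (7 - j) 4).choose δ else 0)) :
    ∑ i ∈ s, ∑ j ∈ range (m + 1), Nat.choose m j *
        (if lo ≤ x i + min j 4 ∧ x i + min j 4 ≤ hi ∧ Θ ≤ (f i + min (m - j) 4) + (x i + min j 4) then
          (f i + min (m - j) 4).choose δ else 0) ≤
      ∑ i ∈ s, ∑ j ∈ range (m + 1), Nat.choose m j *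
        (if lo + δ ≤ f i + min (m - j) 4 ∧ f i + min (m - j) 4 ≤ hi + δ then (f i + min (m - j) 4).choose δ else 0) := by
  -- the preservers `T₃₄` and `δ₄₄`
  have h11 : ∀ lo hi δ Θ : ℕ, Θ ≤ lo + hi + δ → (lo = 0 ∨ lo + hi + δ ≤ Θ) →
      ∑ i ∈ s, (if lo ≤ x i + 1 ∧ x i + 1 ≤ hi ∧ Θ ≤ (f i + 1) + (x i + 1) then (f i + 1).choose δ else 0) ≤
        ∑ i ∈ s, (if lo + δ ≤ f i + 1 ∧ f i + 1 ≤ hi + δ then (f i + 1).choose δ else 0) :=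
    fun lo hi δ Θ h1 h2 => PLDClosure.shift11 s x f hPLD lo hi δ Θ h1 h2
  have h22 : ∀ lo hi δ Θ : ℕ, Θ ≤ lo + hi + δ → (lo = 0 ∨ lo + hi + δ ≤ Θ) →
      ∑ i ∈ s, (if lo ≤ x i + 2 ∧ x i + 2 ≤ hi ∧ Θ ≤ (f i + 2) + (x i + 2) then (f i + 2).choose δ else 0) ≤
        ∑ i ∈ s, (if lo + δ ≤ f i + 2 ∧ f i + 2 ≤ hi + δ then (f i + 2).choose δ else 0) :=
    fun lo hi δ Θ h1 h2 => PLDClosure.shift11 s (fun i => x i + 1) (fun i => f i + 1) h11 lo hi δ Θ h1 h2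
  have h33 : ∀ lo hi δ Θ : ℕ, Θ ≤ lo + hi + δ → (lo = 0 ∨ lo + hi + δ ≤ Θ) →
      ∑ i ∈ s, (if lo ≤ x i + 3 ∧ x i + 3 ≤ hi ∧ Θ ≤ (f i + 3) + (x i + 3) then (f i + 3).choose δ else 0) ≤
        ∑ i ∈ s, (if lo + δ ≤ f i + 3 ∧ f i + 3 ≤ hi + δ then (f i + 3).choose δ else 0) :=
    fun lo hi δ Θ h1 h2 => PLDClosure.shift11 s (fun i => x i + 2) (fun i => f i + 2) h22 lo hi δ Θ h1 h2
  have hT : ∑ i ∈ s, ((if lo ≤ x i + 3 ∧ x i + 3 ≤ hi ∧ Θ ≤ (f i + 4) + (x i + 3) then (f i + 4).choose δ else 0) + (if lo ≤ x i + 4 ∧ x i + 4 ≤ hi ∧ Θ ≤ (f i + 3) + (x i + 4) then (f i + 3).choose δ else 0)) ≤ ∑ i ∈ s, ((if lo + δ ≤ f i + 4 ∧ f i + 4 ≤ hi + δ then (f i + 4).choose δ else 0) + (if lo + δ ≤ f i + 3 ∧ f i + 3 ≤ hi + δ then (f i + 3).choose δ else 0)) :=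
    PLDClosure.coloop s (fun i => x i + 3) (fun i => f i + 3) h33 lo hi δ Θ hΘ hlo
  have hS : ∑ i ∈ s, (if lo ≤ x i + 4 ∧ x i + 4 ≤ hi ∧ Θ ≤ (f i + 4) + (x i + 4) then (f i + 4).choose δ else 0) ≤ ∑ i ∈ s, (if lo + δ ≤ f i + 4 ∧ f i + 4 ≤ hi + δ then (f i + 4).choose δ else 0) :=
    PLDClosure.shift11 s (fun i => x i + 3) (fun i => f i + 3) h33 lo hi δ Θ hΘ hlo
  -- the nine layers, for `m` and for `7`
  have hLm : ∀ n : ℕ, 7 ≤ n → ∀ i ∈ s, ∑ j ∈ range (n + 1), Nat.choose n j *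
        (if lo ≤ x i + min j 4 ∧ x i + min j 4 ≤ hi ∧ Θ ≤ (f i + min (n - j) 4) + (x i + min j 4) then
          (f i + min (n - j) 4).choose δ else 0) =
      (if lo ≤ x i ∧ x i ≤ hi ∧ Θ ≤ (f i + 4) + x i then (f i + 4).choose δ else 0) + n * (if lo ≤ x i + 1 ∧ x i + 1 ≤ hi ∧ Θ ≤ (f i + 4) + (x i + 1) then (f i + 4).choose δ else 0) + n.choose 2 * (if lo ≤ x i + 2 ∧ x i + 2 ≤ hi ∧ Θ ≤ (f i + 4) + (x i + 2) then (f i + 4).choose δ else 0) + n.choose 3 * (if lo ≤ x i + 3 ∧ x i + 3 ≤ hi ∧ Θ ≤ (f i + 4) + (x i + 3) then (f i + 4).choose δ else 0) + (∑ i ∈ Ico 4 (n - 3), n.choose i) * (if lo ≤ x i + 4 ∧ x i + 4 ≤ hi ∧ Θ ≤ (f i + 4) + (x i + 4) then (f i + 4).choose δ else 0) + n.choose 3 * (if lo ≤ x i + 4 ∧ x i + 4 ≤ hi ∧ Θ ≤ (f i + 3) + (x i + 4) then (f i + 3).choose δ else 0) + n.choose 2 * (if lo ≤ x i + 4 ∧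 x i + 4 ≤ hi ∧ Θ ≤ (f i + 2) + (x i + 4) then (f i + 2).choose δ else 0) + n * (if lo ≤ x i + 4 ∧ x i + 4 ≤ hi ∧ Θ ≤ (f i + 1) + (x i + 4) then (f i + 1).choose δ else 0) + (if lo ≤ x i + 4 ∧ x i + 4 ≤ hi ∧ Θ ≤ f i + (x i + 4) then (f i).choose δ else 0) :=
    fun n hn i _ => sum_choose_min_four n hn
      (fun a b => if lo ≤ x i + a ∧ x i + a ≤ hi ∧ Θ ≤ (f i + b) + (x i + a) then (f i + b).choose δ else 0)
  have hRm : ∀ n : ℕ, 7 ≤ n → ∀ i ∈ s, ∑ j ∈ range (n + 1), Nat.choose n j *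
        (if lo + δ ≤ f i + min (n - j) 4 ∧ f i + min (n - j) 4 ≤ hi + δ then (f i + min (n - j) 4).choose δ else 0) =
      (if lo + δ ≤ f i + 4 ∧ f i + 4 ≤ hi + δ then (f i + 4).choose δ else 0) + n * (if lo + δ ≤ f i + 4 ∧ f i + 4 ≤ hi + δ then (f i + 4).choose δ else 0) + n.choose 2 * (if lo + δ ≤ f i + 4 ∧ f i + 4 ≤ hi + δ then (f i + 4).choose δ else 0) + n.choose 3 * (if lo + δ ≤ f i + 4 ∧ f i + 4 ≤ hi + δ then (f i + 4).choose δ else 0) + (∑ i ∈ Ico 4 (n - 3), n.choose i) * (if lo + δ ≤ f i + 4 ∧ f i + 4 ≤ hi + δ then (f i + 4).choose δ else 0) + n.choose 3 * (if lo + δ ≤ f i + 3 ∧ f i + 3 ≤ hi + δ then (f i + 3).choose δ else 0) + n.choose 2 * (if lo + δ ≤ f i + 2 ∧ f i + 2 ≤ hi + δ then (f i + 2).choose δ else 0) + n * (if lo + δ ≤ f i + 1 ∧ f i + 1 ≤ hi + δ then (f i + 1).choose δ else 0) + (if lo + δ ≤ f i ∧ f i ≤ hi + δ then (f i).choose δ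 else 0) :=
    fun n hn i _ => sum_choose_min_four n hn
      (fun _ b => if lo + δ ≤ f i + b ∧ f i + b ≤ hi + δ then (f i + b).choose δ else 0)
  rw [sum_congr rfl (hLm m hm), sum_congr rfl (hRm m hm)]
  rw [sum_congr rfl (hLm 7 le_rfl), sum_congr rfl (hRm 7 le_rfl)] at h₀
  simp only [sum_add_distrib, ← mul_sum] at h₀ hq hq' ⊢
  rw [sum_add_distrib, sum_add_distrib] at hT
  -- the coefficients
  obtain ⟨k, hk⟩ := Nat.exists_eq_add_of_le hm
  obtain ⟨k', hk'⟩ := Nat.exists_eq_add_of_le (sum_choose_mid4_mono 7 m hm)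
  have hC2 : 6 * m.choose 2 = 126 + 39 * k + 3 * k * k := by
    rw [hk, six_mul_choose_two_sub 7 k (by norm_num), show 2 * 7 + k - 1 = 13 + k by omega]
    norm_num [Nat.choose]
    ring
  have hC3 : 6 * m.choose 3 = 210 + 107 * k + 18 * k * k + k * k * k := by
    have h := six_mul_choose_three_sub 7 k (by norm_num)
    rw [← hk] at h
    norm_num [Nat.choose] at h
    nlinarith [h]
  have h7c2 : Nat.choose 7 2 = 21 := by decide
  have h7c3 : Nat.choose 7 3 = 35 := by decide
  rw [h7c2, h7c3] at h₀
  rw [hk']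
  rw [hk] at hC2 hC3 ⊢
  exact lift_alg_solid _ _ _ _ _ _ _ _ _ _ _ _ _ _ _ _ _ _ _ _ _ _ _ hC2 hC3 h₀ hq hq' hT hS

end PLDSolidLift

end PercRepro
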